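import Literature.MathematicalPhysics.QuantumFieldTheory.Balaban1983to89.B8Ineq159CurvedCubeMemberSmallPlaquettes
import Literature.MathematicalPhysics.QuantumFieldTheory.Balaban1983to89.B8Ineq159GaugeCovarianceTower
import Literature.MathematicalPhysics.QuantumFieldTheory.Balaban1983to89.B8Ineq132
import Literature.MathematicalPhysics.QuantumFieldTheory.Balaban1983to89.B7Prop2Explicit

/-!
# `Balaban1983to89.B8Ineq159CurvedCubeMemberInAk` — [Balaban1985RegularSpaces] (1.59) p. 86 «for `U₀ ∈ 𝔄_k({Ω_j}, α₀)`» ON THE CUBE MEMBER, PER MEMBER, IN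
# PRINT'S CLASS CURRENCY `B8Ineq132.InAk` ((1.7) p. 77), and the all-truncations theorem for UNITARY-valued backgrounds of a C⋆-algebra
# ([Balaban1985Averaging] (42)–(43) pp. 23–24: the unitary group is averaging-closed)

statement-level skeleton of published theorems with citation tags; proofs where landed; nothing here is a claim about the
Yang–Mills mass gap

`[Balaban1985RegularSpaces]` ("B8", CMP **99** (1985) 75–102) p. 77 (`𝔄_k({Ω_j}, α₀)`, (1.7), the touching convention), (1.27)–(1.29) p. 81 (`□_j ⊂ Ω_j`),
(1.38) p. 82, (1.59) p. 86, (1.62) p. 87, p. 98 («a distance between boundaries of these cubes is equal to R₁M₁Lʲη»), (1.131) p. 99; [B7] = `[Balaban1985Averaging]`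
(CMP **98** (1985) 17–51) (42)–(43) pp. 23–24, (22)–(23) p. 21, Prop. 2 (52)–(54) p. 26; [4] = `[Balaban1985BackgroundPropagators]` Thm 3.3 p. 399.

CITATION HEADER (lean-in-tree rule).  Cell `pub-ymgap` (YM Track A, HUMAN RULING D-0062 ∕ D-0149), DAG node N05 = [B8], width seat `pub-ymgap-dag-n05-w3`
(g2), CLAIM-1 file (H), INTENT-11.  WHY.  File (G) of this seat states the per-member curved (1.59) under `B8Lemma1NonAbelian.PlaqSmall` on a box around `□₀`;
print states (1.59) «for `U₀ ∈ 𝔄_k({Ω_j}, α₀)`», typed in the tree as `B8Ineq132.InAk L k η α₀ Ω U₀` (pub-balaban lineage; the currency of the N06 binder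
`B9SupplySockB9P3ZdGammaInAk.CurvAtInAk`).  Files (D′)∕(E′) state the all-truncations theorem for backgrounds valued in an abstract averaging-closed group `G`;
the record's algebras are matrix C⋆-algebras, whose unitary group is averaging-closed (`B7Prop2Explicit.avgClosed_unitaryUnits`).  THIS FILE does both re-keyings.

THE MATHEMATICS (kernel-checked).  §1 `plaqSmall_of_condAt_zero` ∕ `plaqSmall_of_inAk`: the level-`0` plaquette clause of (1.7) on a set `Ω₀` containing the
box `[lo, hi]` gives `PlaqSmall U₀ lo hi α₀` (a plaquette with corners in the box touches `Ω₀`; threshold `α₀L^{−0} = α₀`).  §2 ★★★ `exists_curved159_perCube_inAk`: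
THERE ARE `α₀(□) > 0`, `B′(□) > 0` such that for every `U1`-valued `U₀`, every sequence `{Ω_j}` whose `Ω₀` contains the box `□₀ + (L+4)` and every `k′`,
`U₀ ∈ 𝔄_{k′}({Ω_j}, α₀)` implies the truncation-`1` curved (1.59) conclusion of file (D) (composition of §1 with file (G)).  §3 (C⋆-algebras)
★ `exists_curved159_perCube_unitary`: file (D′)'s all-truncations theorem (`1 ≤ m ≤ k`, `2 ≤ L`) for UNITARY-valued backgrounds `δ₀(□, m)`-close to `1` on
all bonds, and ★ `exists_curved159_perCube_unitary_gauge`: the same along any unit-bounded gauge transformation (file (E′)).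

HONEST SCOPE ∕ A6.  PER MEMBER: `α₀(□), δ₀(□, m), B′` depend on the member and `𝔸`, NOT explicit, NOT print's uniform constants; §2 is truncation `m = 1` and
uses ONLY the level-`0` plaquette clause of (1.7) (neither (1.9) nor the level weights `α₀L^{−2j}`), under the LOCATED side condition «`Ω₀ ⊇ □₀ + (L+4)`» (print:
`□₀ ⊂ Ω₀` with the `R₁M₁`-collar of p. 98 — a reading, stated as a hypothesis, not derived from a typed (1.27)); §3 asks closeness on ALL bonds of `ℤᵈ`.  NOT an
inhabitant of `SockB9P3` ∕ `SockH59` ∕ `CurvAtInAk` as typed; nothing of [4] Thm 3.3's uniformity.  Non-vacuity: `U₀ = 1 ∈ 𝔄_k` for every `α₀ > 0`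
(`B8Ineq132`'s flat lemmas), `φ = 0`.  Count-neutral; N05 NOT discharged; no count claim; one finite `𝕋⁴` programme at fixed `ε`, Bałaban as printed; the YM
mass gap (Clay) is NOT proved by any of this — R4 closes the conditional finite-`𝕋⁴` rung `BalabanLadder.UV` only; nothing continuum ∕ ℝ⁴ ∕ OS.  No `sorry`,
no `def`, no `instance`, no `notation`.  Unit `pub-ymgap-dag-n05-w3` (g2), 2026-08-28.
-/

noncomputable section

namespace Literature.MathematicalPhysics.QuantumFieldTheory.Balaban1983to89.B8Ineq159CurvedCubeMemberInAk

open B7Prop1Explicit B7Prop2Explicit B7Prop1Local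
open B7Prop4GeneralLevels (linCovIter)
open B8Ineq132 (covDerivFwd BondTouches PlaqTouches plaqF CondAt InAk)
open B8Eq140Level (SideTouches)
open B8Eq146AExpansion (iEta)
open B8Eq155JBound (Jcur)
open B8Eq138LandauZd (IsLandau138 covLap)
open B8Eq131Cubes (sqLo sqHi)
open B8Eq131CubesAdmissible (cubeFam)
open B8CubeMemberZd (cubeLamS)
open B8Ineq159FlatCubeMemberPrinted (cubeLamBP)
open B8Ineq159CurvedCubeMemberSmallPlaquettes (exists_curved159_perCube_smallPlaquettes)
open B8Ineq159CurvedCubeMemberPerCubeTower (exists_curved159_perCube)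
open B8Ineq159GaugeCovarianceTower (exists_curved159_perCube_gauge)

-- `Site` alone would resolve to the torus sites of `Setup.lean`; re-export the `ℤ^d` sites of `B7Prop1Explicit`.
export B7Prop1Explicit (Site)

variable {d : ℕ}

/-! ## §1 The level-`0` plaquette clause of (1.7) on `Ω₀ ⊇ [lo, hi]` gives `PlaqSmall` on the box -/

section Bridge

variable {𝔸 : Type*} [NormedRing 𝔸] [NormOneClass 𝔸] [NormedAlgebra ℂ 𝔸] [CompleteSpace 𝔸]

omit [NormOneClass 𝔸] [CompleteSpace 𝔸] in
/-- **(1.7) at level `0` ⟹ the box hypothesis of Lemma 1's axial gauge**: if `(1.7)∕(1.9)` hold at level `0` on a set `S` containing every site of the box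
`[lo, hi]`, then every plaquette with its corners in the box satisfies `‖U₀(∂p) − 1‖ ≤ α` (`B8Lemma1NonAbelian.PlaqSmall`; its lower corner lies in `S`, and the
level-`0` threshold is `αL^{−0} = α`). [cite: Balaban1985RegularSpaces, (1.7) p.77 (with the touching convention before (1.5)), Lemma 1 p.79] -/
theorem plaqSmall_of_condAt_zero {L : ℕ} {η α : ℝ} {S : Set (Site d)} {V : Site d → Fin d → 𝔸ˣ} {lo hi : Site d}
    (h : CondAt L η α 0 S V) (hS : ∀ x, InBox lo hi x → x ∈ S) : B8Lemma1NonAbelian.PlaqSmall V lo hi α := by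
  intro x κ μ hκμ hlo hhi
  have hx : InBox lo hi x := fun i => by
    refine ⟨hlo i, le_trans ?_ (hhi i)⟩
    simp only [Pi.add_apply, e_apply]
    split_ifs <;> omega
  have h1 := h.1 x κ μ hκμ (Or.inl (hS x hx))
  simp only [pow_zero, inv_one, one_pow, mul_one] at h1
  exact h1.le

omit [NormOneClass 𝔸] [CompleteSpace 𝔸] in
/-- **`U₀ ∈ 𝔄_k({Ω_j}, α₀)` with `Ω₀ ⊇ [lo, hi]` ⟹ `PlaqSmall U₀ lo hi α₀`** (the level-`0` clause of `B8Ineq132.InAk`).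
[cite: Balaban1985RegularSpaces, (1.7) p.77, p.77 (definition of 𝔄_k({Ω_j}, α₀))] -/
theorem plaqSmall_of_inAk {L k : ℕ} {η α : ℝ} {Ω : ℕ → Set (Site d)} {V : Site d → Fin d → 𝔸ˣ} {lo hi : Site d}
    (h : InAk L k η α Ω V) (hΩ : ∀ x, InBox lo hi x → x ∈ Ω 0) : B8Lemma1NonAbelian.PlaqSmall V lo hi α :=
  plaqSmall_of_condAt_zero (h 0 (Nat.zero_le _)) hΩ

end Bridge

/-! ## §2 The per-member curved (1.59), truncation `1`, for `U₀ ∈ 𝔄_k({Ω_j}, α₀)` with `Ω₀ ⊇ □₀ + (L+4)` -/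

section InAkMember

variable {𝔸 : Type*} [NormedRing 𝔸] [NormOneClass 𝔸] [NormedAlgebra ℂ 𝔸] [CompleteSpace 𝔸]

/-- ★★★ **(1.59) «FOR `U₀ ∈ 𝔄_k({Ω_j}, α₀)`» ON THE CUBE MEMBER, PER MEMBER, TRUNCATION `m = 1`.**  For every cube member `□ = (L, a, M, ρ, k)` with `L ≤ ρ`,
`k ≥ 1` (`d ≥ 2`, `η > 0`) there are `α₀ > 0`, `B′ > 0` such that: for every `U1`-valued background `U₀`, every sequence of regions `{Ω_j}` whose top region `Ω₀`
contains the box `[sqLo₀ − (L+4)𝟙, sqHi₀ + (L+4)𝟙]` around `□₀` (print: `□_j ⊂ Ω_j` with the `R₁M₁`-collars of p. 98) and every `k′`, if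
`U₀ ∈ 𝔄_{k′}({Ω_j}, α₀)` (`B8Ineq132.InAk`: (1.7) `‖U₀(∂p) − 1‖ < α₀L^{−2j}` on the plaquettes of `Ω_j` and (1.9), `j ≤ k′`), then for every `φ` in the curved
Landau gauge (1.38) of `U₀` at truncation `1` (multiplier form, `Λ′`-tower `cubeLamS … 1`) supported on the side-touching bonds of `□₀ ∕ □₁`, and every `N ≥ 0`
bounding (i) `(Lʲη)³|J_{U₀}φ|` on the bonds of `□_j`, (ii) `|Lʲη·Q_j(U₀)(iηφ)|` on print's class `cubeLamBP … 1 j`, (iii) `η|φ|` on the outer layer: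
`(Lʲη)|φ| ≤ B′N`, `(Lʲη)²|D^η_{U₀,ν}φ_τ| ≤ B′N`, `(Lʲη)³|Δ^η_{U₀}φ_τ| ≤ B′N` on the bonds side-touching `□_j`, `j ≤ 1` — print's «|A|₍₋₁₎, |∇^η_{U₀}A|₍₋₂₎,
|Δ^η_{U₀}A|₍₋₃₎ ≦ B₀(|J|₍₋₃₎ + |B₁|)» in the pointwise form (1.62), with a member-dependent constant.  PROOF: §1 and file (G)
(`B8Ineq159CurvedCubeMemberSmallPlaquettes.exists_curved159_perCube_smallPlaquettes`).  HONEST SCOPE in the module docstring (per member; only the level-`0`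
plaquette clause of (1.7) is used; `Ω₀ ⊇ □₀ + (L+4)` is a stated side condition; NOT [4] Thm 3.3).
[cite: Balaban1985RegularSpaces, (1.59) p.86, (1.62) p.87, (1.7) p.77, (1.27)–(1.29) p.81, (1.38) p.82, (1.131) p.99, p.98; Balaban1985BackgroundPropagators, Thm 3.3 p.399] -/
theorem exists_curved159_perCube_inAk [FiniteDimensional ℂ 𝔸] (hd2 : 2 ≤ d) {L : ℕ} (hL : 1 ≤ L) {η : ℝ} (hη : 0 < η)
    (a : Site d) (M : ℕ) {ρ : ℕ} (hρ : L ≤ ρ) {k : ℕ} (hk : 1 ≤ k) :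
    ∃ α₀ B' : ℝ, 0 < α₀ ∧ 0 < B' ∧ ∀ (U₀ : Site d → Fin d → 𝔸ˣ), (∀ x κ, U₀ x κ ∈ U1 𝔸) →
      ∀ (Ω : ℕ → Set (Site d)) (k' : ℕ),
        (∀ x, InBox (sqLo L a ρ k 0 - ((L : ℤ) + 4) • (1 : Site d)) (sqHi L a M ρ k 0 + ((L : ℤ) + 4) • (1 : Site d)) x → x ∈ Ω 0) →
        InAk L k' η α₀ Ω U₀ →
      ∀ φ : Site d → Fin d → 𝔸,
        IsLandau138 L 1 η (cubeFam false L a M ρ k 0) (cubeLamS L a M ρ k 1) U₀ φ →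
        (∀ (y : Site d) (τ : Fin d), (∀ j, j ≤ 1 → ¬ SideTouches (cubeFam false L a M ρ k j) y τ) → φ y τ = 0) →
        ∀ N : ℝ, 0 ≤ N →
          (∀ j, j ≤ 1 → ∀ (y : Site d) (τ : Fin d), BondTouches (cubeFam false L a M ρ k j) y τ →
              ((L : ℝ) ^ j * η) ^ 3 * ‖Jcur η U₀ φ τ y‖ ≤ N) →
          (∀ j, j ≤ 1 → ∀ c ∈ cubeLamBP L a M ρ k 1 j, ‖linCovIter L U₀ (iEta η φ) j c.1 c.2‖ ≤ N) →
          (∀ (y : Site d) (τ : Fin d), ¬ BondTouches (cubeFam false L a M ρ k 0) y τ → η * ‖φ y τ‖ ≤ N) →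
          ∀ j, j ≤ 1 → ∀ (y : Site d) (τ : Fin d), SideTouches (cubeFam false L a M ρ k j) y τ →
            ((L : ℝ) ^ j * η) * ‖φ y τ‖ ≤ B' * N ∧
            (∀ ν : Fin d, ((L : ℝ) ^ j * η) ^ 2 * ‖covDerivFwd η U₀ ν (fun z => φ z τ) y‖ ≤ B' * N) ∧
            ((L : ℝ) ^ j * η) ^ 3 * ‖covLap η U₀ (fun z => φ z τ) y‖ ≤ B' * N := by
  obtain ⟨a₀, B', ha₀, hB', H⟩ := exists_curved159_perCube_smallPlaquettes (𝔸 := 𝔸) hd2 hL hη a M hρ hk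
  exact ⟨a₀, B', ha₀, hB', fun U₀ hU Ω k' hΩ hAk => H U₀ hU (plaqSmall_of_inAk hAk hΩ)⟩

end InAkMember

/-! ## §3 C⋆-algebras: the all-truncations theorem for unitary-valued backgrounds ([B7] (42)–(43): `U(𝔸)` is averaging-closed) -/

section Unitary

variable {𝔸 : Type*} [CStarAlgebra 𝔸] [Nontrivial 𝔸]

/-- ★ **(1.59) AT A CURVED UNITARY BACKGROUND ON THE CUBE MEMBER, PER MEMBER, ALL TRUNCATIONS `1 ≤ m ≤ k`** (C⋆-algebra coefficients, `2 ≤ L`): file (D′)'s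
`exists_curved159_perCube` at the averaging-closed group `G := U(𝔸)` (`B7Prop2Explicit.avgClosed_unitaryUnits`: the averages (42)–(43) of unitary configurations
near `1` are unitary, (22)–(23)).  There are `δ₀(□, m) > 0`, `B′(□, m) > 0` such that for every UNITARY-valued `U₀` with `‖U₀(b) − 1‖ ≤ δ₀` on all bonds, every `φ`
in the curved Landau gauge (1.38) of `U₀` at truncation `m` supported on the side-touching bonds of the `□_j`, `j ≤ m`, and every `N ≥ 0` bounding the curved data
(i)–(iii): `(Lʲη)|φ|, (Lʲη)²|D^η_{U₀,ν}φ_τ|, (Lʲη)³|Δ^η_{U₀}φ_τ| ≤ B′N` on the sides of `□_j`, `j ≤ m`.  HONEST SCOPE: per member and per truncation, non-explicit;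
closeness asked on ALL bonds of `ℤᵈ`; NOT [4] Thm 3.3.
[cite: Balaban1985RegularSpaces, (1.59) p.86, (1.62) p.87, (1.38) p.82, (1.131) p.99; Balaban1985Averaging, (42)–(43) pp.23–24, (22)–(23) p.21, Prop. 2 (52)–(54) p.26; Balaban1985BackgroundPropagators, Thm 3.3 p.399] -/
theorem exists_curved159_perCube_unitary [FiniteDimensional ℂ 𝔸] (hd2 : 2 ≤ d) {L : ℕ} (hL2 : 2 ≤ L) {η : ℝ} (hη : 0 < η)
    (a : Site d) (M ρ : ℕ) {k m : ℕ} (hm1 : 1 ≤ m) (hmk : m ≤ k) :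
    ∃ δ₀ B' : ℝ, 0 < δ₀ ∧ 0 < B' ∧ ∀ (U₀ : Site d → Fin d → 𝔸ˣ), (∀ x κ, U₀ x κ ∈ unitaryUnits 𝔸) →
      (∀ x κ, ‖((U₀ x κ : 𝔸ˣ) : 𝔸) - 1‖ ≤ δ₀) →
      ∀ φ : Site d → Fin d → 𝔸,
        IsLandau138 L m η (cubeFam false L a M ρ k 0) (cubeLamS L a M ρ k m) U₀ φ →
        (∀ (y : Site d) (τ : Fin d), (∀ j, j ≤ m → ¬ SideTouches (cubeFam false L a M ρ k j) y τ) → φ y τ = 0) →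
        ∀ N : ℝ, 0 ≤ N →
          (∀ j, j ≤ m → ∀ (y : Site d) (τ : Fin d), BondTouches (cubeFam false L a M ρ k j) y τ →
              ((L : ℝ) ^ j * η) ^ 3 * ‖Jcur η U₀ φ τ y‖ ≤ N) →
          (∀ j, j ≤ m → ∀ c ∈ cubeLamBP L a M ρ k m j, ‖linCovIter L U₀ (iEta η φ) j c.1 c.2‖ ≤ N) →
          (∀ (y : Site d) (τ : Fin d), ¬ BondTouches (cubeFam false L a M ρ k 0) y τ → η * ‖φ y τ‖ ≤ N) →
          ∀ j, j ≤ m → ∀ (y : Site d) (τ : Fin d), SideTouches (cubeFam false L a M ρ k j) y τ →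
            ((L : ℝ) ^ j * η) * ‖φ y τ‖ ≤ B' * N ∧
            (∀ ν : Fin d, ((L : ℝ) ^ j * η) ^ 2 * ‖covDerivFwd η U₀ ν (fun z => φ z τ) y‖ ≤ B' * N) ∧
            ((L : ℝ) ^ j * η) ^ 3 * ‖covLap η U₀ (fun z => φ z τ) y‖ ≤ B' * N :=
  exists_curved159_perCube (𝔸 := 𝔸) hd2 hL2 hη (avgClosed_unitaryUnits d L) a M ρ hm1 hmk

/-- ★ **The unitary all-truncations theorem along gauge transformations**: file (E′)'s `exists_curved159_perCube_gauge` at `G := U(𝔸)` — for every unit-bounded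
gauge transformation `u` and every unitary-valued `V` with `‖V(b) − 1‖ ≤ δ₀` on all bonds, the conclusion of `exists_curved159_perCube_unitary` holds at the
background `V^u` (same constants). [cite: Balaban1985RegularSpaces, p.77 (gauge invariance of 𝔄_k), (1.11) p.78, (1.59) p.86; Balaban1985Averaging, (42)–(43) pp.23–24, (11) p.19] -/
theorem exists_curved159_perCube_unitary_gauge [FiniteDimensional ℂ 𝔸] (hd2 : 2 ≤ d) {L : ℕ} (hL2 : 2 ≤ L) {η : ℝ} (hη : 0 < η)
    (a : Site d) (M ρ : ℕ) {k m : ℕ} (hm1 : 1 ≤ m) (hmk : m ≤ k) :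
    ∃ δ₀ B' : ℝ, 0 < δ₀ ∧ 0 < B' ∧ ∀ (u : Site d → 𝔸ˣ), (∀ x, u x ∈ U1 𝔸) →
      ∀ (V : Site d → Fin d → 𝔸ˣ), (∀ x κ, V x κ ∈ unitaryUnits 𝔸) → (∀ x κ, ‖((V x κ : 𝔸ˣ) : 𝔸) - 1‖ ≤ δ₀) →
      ∀ φ : Site d → Fin d → 𝔸,
        IsLandau138 L m η (cubeFam false L a M ρ k 0) (cubeLamS L a M ρ k m) (gaugeAct u V) φ →
        (∀ (y : Site d) (τ : Fin d), (∀ j, j ≤ m → ¬ SideTouches (cubeFam false L a M ρ k j) y τ) → φ y τ = 0) →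
        ∀ N : ℝ, 0 ≤ N →
          (∀ j, j ≤ m → ∀ (y : Site d) (τ : Fin d), BondTouches (cubeFam false L a M ρ k j) y τ →
              ((L : ℝ) ^ j * η) ^ 3 * ‖Jcur η (gaugeAct u V) φ τ y‖ ≤ N) →
          (∀ j, j ≤ m → ∀ c ∈ cubeLamBP L a M ρ k m j, ‖linCovIter L (gaugeAct u V) (iEta η φ) j c.1 c.2‖ ≤ N) →
          (∀ (y : Site d) (τ : Fin d), ¬ BondTouches (cubeFam false L a M ρ k 0) y τ → η * ‖φ y τ‖ ≤ N) →
          ∀ j, j ≤ m → ∀ (y : Site d) (τ : Fin d), SideTouches (cubeFam false L a M ρ k j) y τ →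
            ((L : ℝ) ^ j * η) * ‖φ y τ‖ ≤ B' * N ∧
            (∀ ν : Fin d, ((L : ℝ) ^ j * η) ^ 2 * ‖covDerivFwd η (gaugeAct u V) ν (fun z => φ z τ) y‖ ≤ B' * N) ∧
            ((L : ℝ) ^ j * η) ^ 3 * ‖covLap η (gaugeAct u V) (fun z => φ z τ) y‖ ≤ B' * N :=
  exists_curved159_perCube_gauge (𝔸 := 𝔸) hd2 hL2 hη (avgClosed_unitaryUnits d L) a M ρ hm1 hmk

end Unitary

end Literature.MathematicalPhysics.QuantumFieldTheory.Balaban1983to89.B8Ineq159CurvedCubeMemberInAk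

end
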